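import Literature.IUT.LogVolume.Theorem110
import Literature.IUT.LogVolume.Theorem110LocalBounds
import HarnessLib

/-!
# [IUTchIV] Theorem 1.10: assembly of the local (per-`v_ℚ`) bounds of Steps (v)–(vii) into the proof data
# of Steps (ii), (iii), (viii)

Mochizuki, *Inter-universal Teichmüller theory IV*, RIMS manuscript (Apr. 2020; = PRIMS **57** (2021)),
proof of Theorem 1.10, pp. 23–31. TAKES NO SIDE ([IUTchIII] Cor. 3.12 stays the hypothesis `Cor312`).

`Theorem110LocalBounds.lean` proves the averaging of Steps (v)–(viii) from per-collection component bounds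
and ends with a global inequality `hull_bound_of_local_bounds`; `Theorem110Data.lean`/`Theorem110.lean`
start from the field `ProofData.hull_le` of the same printed shape and prove `C_Θ`-admissibility and the
displayed inequalities. This file certifies IN THE KERNEL that the two shapes match: from
`LocalProofData` — the per-`v_ℚ` data (`DstLocal`, component volumes and their printed bounds, the
non-distinguished contribution `Z ≤ 0`, the archimedean term), the Def. 1.9 bookkeeping identities
"`Σ_{v_ℚ} log(𝔡^K_{v_ℚ}) = log(𝔡^K)`, `Σ_{v_ℚ} log(q_{v_ℚ}) = log(q)`, `Σ_{v_ℚ} log(𝔰^ℚ_{v_ℚ}) = log(𝔰^ℚ)`,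
`Σ_{v_ℚ} log(𝔰^≤_{v_ℚ}) = log(𝔰^≤)`" (degrees of arithmetic divisors are sums of local degrees; all four
divisors are supported in `𝕍^dst` by (D1)–(D7), p. 25), and the Step (ii)/(iii) inequalities — it
BUILDS `ProofData` (`LocalProofData.toProofData`) and hence gives Theorem 1.10 from local data
(`theorem110_of_local`). With `l = 2·l⋇ + 1` (`l` an odd prime).

Deliberately NOT here: the component-volume bounds themselves (Props. 1.4, 1.5, (R4)); Def. 1.9.
-/

/-! (Revision note.) `LocalProofDataAvg` / `theorem110_of_localAvg` carry the Step (v) hypothesis in its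
PRINTED weighted-average form (p. 28); `LocalProofData` keeps the per-collection form [modelling: stronger than
print], with `LocalProofData.toAvg`. Referee finding B5-1; plan/c312/STEPV-IND1-NOTE.md. -/

noncomputable section

namespace Literature.IUT.LogVolume

namespace Thm110Numerics

open Thm110Local Finset

variable {X : Thm110Numerics}

/-- `l⋇ := (l−1)/2`; for the odd prime `l`, `l = 2·l⋇ + 1` ([IUTchI] Def. 3.1 (c): `l ≥ 5` prime).
[claim: Mochizuki2012, status: disputed] -/
def lhalf (X : Thm110Numerics) : ℕ := X.l / 2

/-- `l = 2·l⋇ + 1` (the prime `l ≥ 5` is odd). [claim: Mochizuki2012, status: disputed] -/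
theorem l_eq_two_mul_lhalf_add_one (X : Thm110Numerics) : X.l = 2 * X.lhalf + 1 := by
  have hodd : Odd X.l := X.prime_l.odd_of_ne_two (by have := X.five_le_l; omega)
  obtain ⟨m, hm⟩ := hodd
  unfold lhalf; omega

/-- `l⋇ ≥ 2` (since `l ≥ 5`). [claim: Mochizuki2012, status: disputed] -/
theorem two_le_lhalf (X : Thm110Numerics) : 2 ≤ X.lhalf := by
  have := X.five_le_l; unfold lhalf; omega

/-- `(l : ℝ) = 2·l⋇ + 1`. [claim: Mochizuki2012, status: disputed] -/
theorem l_real_eq (X : Thm110Numerics) : (X.l : ℝ) = 2 * (X.lhalf : ℝ) + 1 := by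
  have := X.l_eq_two_mul_lhalf_add_one; exact_mod_cast this

/-- The LOCAL proof data of Theorem 1.10 for the numerics `X`: over the finite set `dst = 𝕍_ℚ^dst` of
distinguished rational primes, for each `v_ℚ` the Step (v) data `DstLocal` on `E_{v_ℚ} = 𝕍(F_mod)_{v_ℚ}`
and component volumes `vol(v_ℚ, j, e⃗)` bounded by the printed per-collection bounds (Props. 1.4 (iii),
(R4)); the non-distinguished contribution `Z ≤ 0` (Step (vi), Prop. 1.4 (iv)); the bound of `−|log(Θ)|` by
the sum of these procession-normalized weighted averages plus the archimedean `(1/l⋇)Σ_j (j+1)·log(π)`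
(Steps (iv), (vii); [IUTchIII] Thm 3.11 with (Ind1–3)); the identifications of the global degrees with the
sums of the local ones (Def. 1.9; (D1)–(D7)); and the Step (ii)/(iii) inequalities (Props. 1.3, 1.8).
[claim: Mochizuki2012, status: disputed] -/
structure LocalProofData (X : Thm110Numerics) where
  /-- index type of rational primes -/
  ι : Type
  /-- `𝕍_ℚ^dst` -/
  dst : Finset ι
  /-- `E_{v_ℚ} = 𝕍(F_mod)_{v_ℚ}` -/
  E : ι → Type
  /-- finiteness of `𝕍(F_mod)_{v_ℚ}` -/
  instFintype : ∀ v, Fintype (E v)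
  /-- nonemptiness of `𝕍(F_mod)_{v_ℚ}` -/
  instNonempty : ∀ v, Nonempty (E v)
  /-- the Step (v) data at each distinguished `v_ℚ` -/
  D : ∀ v, @DstLocal (E v) (instFintype v)
  /-- component log-volumes `vol(v_ℚ, j, e⃗)` of the hull -/
  vol : ∀ v, (j : ℕ) → (Fin (j + 1) → E v) → ℝ
  /-- Step (v): each component volume is bounded by the printed per-collection bound -/
  hvol : ∀ v ∈ dst, ∀ j, 1 ≤ j → j ≤ X.lhalf → ∀ e,
    vol v j e ≤ @DstLocal.collBound (E v) (instFintype v) (D v) (2 * (X.lhalf : ℝ) + 1) X.lstar j e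
  /-- Step (vi): the non-distinguished nonarchimedean contribution -/
  Z : ℝ
  /-- Step (vi): it is `≤ 0` -/
  hZ : Z ≤ 0
  /-- Steps (iv), (vii): `−|log(Θ)| ≤ Σ_{v_ℚ ∈ dst} procAvg_j wavg_{e⃗} vol + Z + procAvg_j (j+1)·log(π)` -/
  negLogTheta_le : X.negLogTheta ≤
    (∑ v ∈ dst, procAvg X.lhalf (fun j => @DstLocal.wavg (E v) (instFintype v) (D v) (j + 1) (vol v j)))
      + Z + procAvg X.lhalf (fun j => ((j : ℝ) + 1) * Real.log Real.pi)
  /-- `log(𝔡^K)` -/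
  logDiffK : ℝ
  /-- `log(𝔣^K) ≥ 0` -/
  logCondK : ℝ
  /-- as printed -/
  logCondK_nonneg : 0 ≤ logCondK
  /-- Def. 1.9 / (D5): `Σ_{v_ℚ ∈ dst} log(𝔡^K_{v_ℚ}) = log(𝔡^K)` -/
  sum_logDK : ∑ v ∈ dst, @DstLocal.avg (E v) (instFintype v) (D v) (D v).logDK = logDiffK
  /-- Def. 1.9 / (D6): `Σ_{v_ℚ ∈ dst} log(q_{v_ℚ}) = log(q)` -/
  sum_logQ : ∑ v ∈ dst, @DstLocal.avg (E v) (instFintype v) (D v) (D v).logQ = X.logq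
  /-- Step (ii), first display (Prop. 1.3 (i)) -/
  tpd_le_F : X.logDiffTpd + X.logCondTpd ≤ X.logDiffF + X.logCondF
  /-- Step (ii), second display, first inequality (Props. 1.3, 1.8) -/
  F_le : X.logDiffF + X.logCondF ≤ X.logDiffTpd + X.logCondTpd + Real.log (2 ^ 11 * 3 ^ 3 * 5 ^ 2)
  /-- Step (ii), third display, middle inequality (Prop. 1.3) -/
  K_le : logDiffK + logCondK ≤ X.logDiffF + X.logCondF + 2 * Real.log X.l
  /-- Step (iii): `log(𝔰^ℚ) = Σ_{v_ℚ ∈ dst} log(p_{v_ℚ}) ≤ 2·d_mod·(log(𝔡^{F_tpd}) + log(𝔣^{F_tpd})) + log(2·3·5·l)` -/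
  sQ_le : ∑ v ∈ dst, (D v).logp ≤
    2 * (X.dmod : ℝ) * (X.logDiffTpd + X.logCondTpd) + Real.log (2 * 3 * 5 * (X.l : ℝ))
  /-- definition of `𝔰^≤`: `log(𝔰^≤) = Σ_{v_ℚ ∈ dst} ι_{v_ℚ} ≤ π(e*_mod·l)` -/
  sLe_le : ∑ v ∈ dst, (D v).iota ≤ (Nat.primeCounting (X.estar * X.l) : ℝ)

namespace LocalProofData

attribute [instance] LocalProofData.instFintype LocalProofData.instNonempty

variable (L : X.LocalProofData)

/-- `log(𝔡^K) ≥ 0` (a `λ`-average of nonnegative local terms, summed). [claim: Mochizuki2012, status: disputed] -/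
theorem logDiffK_nonneg : 0 ≤ L.logDiffK := by
  rw [← L.sum_logDK]
  refine Finset.sum_nonneg fun v _ => ?_
  unfold DstLocal.avg Literature.Algebra.PolynomialIdentities.WeightedAverage.betaAvg
    Literature.Algebra.PolynomialIdentities.WeightedAverage.betaTotal
  exact div_nonneg
    (Finset.sum_nonneg fun w _ => mul_nonneg ((L.D v).logDK_nonneg w) ((L.D v).lam_pos w).le)
    (Literature.Algebra.PolynomialIdentities.WeightedAverage.lamTotal_pos (L.D v).lam_pos).le

/-- **The assembly**: local proof data determine `ProofData` — the field `hull_le` is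
`hull_bound_of_local_bounds` with `l = 2l⋇ + 1`, `log(𝔰^ℚ) := Σ log(p_{v_ℚ})`, `log(𝔰^≤) := Σ ι_{v_ℚ}` and the
Def. 1.9 identifications. [claim: Mochizuki2012, status: disputed] -/
def toProofData : X.ProofData where
  logDiffK := L.logDiffK
  logDiffK_nonneg := L.logDiffK_nonneg
  logCondK := L.logCondK
  logCondK_nonneg := L.logCondK_nonneg
  logsQ := ∑ v ∈ L.dst, (L.D v).logp
  logsQ_nonneg := Finset.sum_nonneg fun v _ => (L.D v).logp_nonneg
  logsLe := ∑ v ∈ L.dst, (L.D v).iota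
  logsLe_nonneg := Finset.sum_nonneg fun v _ => (L.D v).iota_nonneg
  tpd_le_F := L.tpd_le_F
  F_le := L.F_le
  K_le := L.K_le
  sQ_le := L.sQ_le
  sLe_le := L.sLe_le
  hull_le := by
    have hlstar : 0 ≤ X.lstar := by
      unfold lstar
      have he := X.estar_ge; have hl := X.five_le_l_real
      exact Real.log_nonneg (by nlinarith)
    have h := hull_bound_of_local_bounds L.dst L.D X.two_le_lhalf hlstar (Real.log Real.pi) L.vol L.hvol
      L.hZ L.negLogTheta_le
    rw [L.sum_logDK, L.sum_logQ, ← X.l_real_eq] at h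
    exact h

include L in
/-- **[IUTchIV] Theorem 1.10 from local data**: `LocalProofData → IsEtaPrm η_prm → l ≠ 5 → Cor312 →
(C_Θ admissible ∧ C_Θ ≥ −1 ∧ Display ∧ DisplayF)`. [claim: Mochizuki2012, status: disputed] -/
theorem theorem110_of_local (hη : IsEtaPrm X.etaPrm) (hne : X.l ≠ 5) (hcor : X.Cor312) :
    X.CThetaAdmissible ∧ -1 ≤ X.CTheta ∧ X.Display ∧ X.DisplayF :=
  theorem110 L.toProofData hη hne hcor

end LocalProofData

/-- The local proof data with the Step (v) hypothesis in its PRINTED form — the weighted-average bound after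
symmetrization (p. 28), instead of the per-collection bound `hvol` of `LocalProofData` [modelling: `hvol` is
stronger than print; referee finding B5-1 / plan/c312/STEPV-IND1-NOTE.md]. [claim: Mochizuki2012, status: disputed] -/
structure LocalProofDataAvg (X : Thm110Numerics) where
  /-- index type of rational primes -/
  ι : Type
  /-- `𝕍_ℚ^dst` -/
  dst : Finset ι
  /-- `E_{v_ℚ} = 𝕍(F_mod)_{v_ℚ}` -/
  E : ι → Type
  /-- finiteness of `𝕍(F_mod)_{v_ℚ}` -/
  instFintype : ∀ v, Fintype (E v)
  /-- nonemptiness of `𝕍(F_mod)_{v_ℚ}` -/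
  instNonempty : ∀ v, Nonempty (E v)
  /-- the Step (v) data at each distinguished `v_ℚ` -/
  D : ∀ v, @DstLocal (E v) (instFintype v)
  /-- component log-volumes `vol(v_ℚ, j, e⃗)` of the hull -/
  vol : ∀ v, (j : ℕ) → (Fin (j + 1) → E v) → ℝ
  /-- Step (v), PRINTED FORM (p. 28, final display): for each `j`, the `λ`-weighted average over collections
  of the component volumes is `≤ (j+1)·log(𝔡^K_{v_ℚ}) − (j²/2l)·log(q_{v_ℚ}) + log(𝔰^ℚ_{v_ℚ}) + 4(j+1)·ι·l*_mod` -/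
  hwavg : ∀ v ∈ dst, ∀ j, 1 ≤ j → j ≤ X.lhalf →
    @DstLocal.wavg (E v) (instFintype v) (D v) (j + 1) (vol v j) ≤
      ((j : ℝ) + 1) * @DstLocal.avg (E v) (instFintype v) (D v) (D v).logDK
        - (j : ℝ) ^ 2 / (2 * (2 * (X.lhalf : ℝ) + 1)) * @DstLocal.avg (E v) (instFintype v) (D v) (D v).logQ
        + (D v).logp + 4 * ((j : ℝ) + 1) * ((D v).iota * X.lstar)
  /-- Step (vi): the non-distinguished nonarchimedean contribution -/
  Z : ℝ
  /-- Step (vi): it is `≤ 0` -/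
  hZ : Z ≤ 0
  /-- Steps (iv), (vii): `−|log(Θ)| ≤ Σ_{v_ℚ ∈ dst} procAvg_j wavg_{e⃗} vol + Z + procAvg_j (j+1)·log(π)` -/
  negLogTheta_le : X.negLogTheta ≤
    (∑ v ∈ dst, procAvg X.lhalf (fun j => @DstLocal.wavg (E v) (instFintype v) (D v) (j + 1) (vol v j)))
      + Z + procAvg X.lhalf (fun j => ((j : ℝ) + 1) * Real.log Real.pi)
  /-- `log(𝔡^K)` -/
  logDiffK : ℝ
  /-- `log(𝔣^K) ≥ 0` -/
  logCondK : ℝ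
  /-- as printed -/
  logCondK_nonneg : 0 ≤ logCondK
  /-- Def. 1.9 / (D5): `Σ_{v_ℚ ∈ dst} log(𝔡^K_{v_ℚ}) = log(𝔡^K)` -/
  sum_logDK : ∑ v ∈ dst, @DstLocal.avg (E v) (instFintype v) (D v) (D v).logDK = logDiffK
  /-- Def. 1.9 / (D6): `Σ_{v_ℚ ∈ dst} log(q_{v_ℚ}) = log(q)` -/
  sum_logQ : ∑ v ∈ dst, @DstLocal.avg (E v) (instFintype v) (D v) (D v).logQ = X.logq
  /-- Step (ii), first display (Prop. 1.3 (i)) -/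
  tpd_le_F : X.logDiffTpd + X.logCondTpd ≤ X.logDiffF + X.logCondF
  /-- Step (ii), second display, first inequality (Props. 1.3, 1.8) -/
  F_le : X.logDiffF + X.logCondF ≤ X.logDiffTpd + X.logCondTpd + Real.log (2 ^ 11 * 3 ^ 3 * 5 ^ 2)
  /-- Step (ii), third display, middle inequality (Prop. 1.3) -/
  K_le : logDiffK + logCondK ≤ X.logDiffF + X.logCondF + 2 * Real.log X.l
  /-- Step (iii): `log(𝔰^ℚ) = Σ_{v_ℚ ∈ dst} log(p_{v_ℚ}) ≤ 2·d_mod·(log(𝔡^{F_tpd}) + log(𝔣^{F_tpd})) + log(2·3·5·l)` -/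
  sQ_le : ∑ v ∈ dst, (D v).logp ≤
    2 * (X.dmod : ℝ) * (X.logDiffTpd + X.logCondTpd) + Real.log (2 * 3 * 5 * (X.l : ℝ))
  /-- definition of `𝔰^≤`: `log(𝔰^≤) = Σ_{v_ℚ ∈ dst} ι_{v_ℚ} ≤ π(e*_mod·l)` -/
  sLe_le : ∑ v ∈ dst, (D v).iota ≤ (Nat.primeCounting (X.estar * X.l) : ℝ)


namespace LocalProofDataAvg

attribute [instance] LocalProofDataAvg.instFintype LocalProofDataAvg.instNonempty

variable (L : X.LocalProofDataAvg)

/-- `log(𝔡^K) ≥ 0`. [claim: Mochizuki2012, status: disputed] -/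
theorem logDiffK_nonneg : 0 ≤ L.logDiffK := by
  rw [← L.sum_logDK]
  refine Finset.sum_nonneg fun v _ => ?_
  unfold DstLocal.avg Literature.Algebra.PolynomialIdentities.WeightedAverage.betaAvg
    Literature.Algebra.PolynomialIdentities.WeightedAverage.betaTotal
  exact div_nonneg
    (Finset.sum_nonneg fun w _ => mul_nonneg ((L.D v).logDK_nonneg w) ((L.D v).lam_pos w).le)
    (Literature.Algebra.PolynomialIdentities.WeightedAverage.lamTotal_pos (L.D v).lam_pos).le

/-- **The assembly from the printed (weighted-average) Step (v) hypothesis**: `hull_le` is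
`hull_bound_of_wavg_bounds`. [claim: Mochizuki2012, status: disputed] -/
def toProofData : X.ProofData where
  logDiffK := L.logDiffK
  logDiffK_nonneg := L.logDiffK_nonneg
  logCondK := L.logCondK
  logCondK_nonneg := L.logCondK_nonneg
  logsQ := ∑ v ∈ L.dst, (L.D v).logp
  logsQ_nonneg := Finset.sum_nonneg fun v _ => (L.D v).logp_nonneg
  logsLe := ∑ v ∈ L.dst, (L.D v).iota
  logsLe_nonneg := Finset.sum_nonneg fun v _ => (L.D v).iota_nonneg
  tpd_le_F := L.tpd_le_F
  F_le := L.F_le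
  K_le := L.K_le
  sQ_le := L.sQ_le
  sLe_le := L.sLe_le
  hull_le := by
    have hlstar : 0 ≤ X.lstar := by
      unfold lstar
      have he := X.estar_ge; have hl := X.five_le_l_real
      exact Real.log_nonneg (by nlinarith)
    have h := hull_bound_of_wavg_bounds L.dst L.D X.two_le_lhalf hlstar (Real.log Real.pi) L.vol L.hwavg
      L.hZ L.negLogTheta_le
    rw [L.sum_logDK, L.sum_logQ, ← X.l_real_eq] at h
    exact h

include L in
/-- **[IUTchIV] Theorem 1.10 from local data in the printed form**: `LocalProofDataAvg → IsEtaPrm η_prm → l ≠ 5 →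
Cor312 → (C_Θ admissible ∧ C_Θ ≥ −1 ∧ Display ∧ DisplayF)`. [claim: Mochizuki2012, status: disputed] -/
theorem theorem110_of_localAvg (hη : IsEtaPrm X.etaPrm) (hne : X.l ≠ 5) (hcor : X.Cor312) :
    X.CThetaAdmissible ∧ -1 ≤ X.CTheta ∧ X.Display ∧ X.DisplayF :=
  theorem110 L.toProofData hη hne hcor

end LocalProofDataAvg

/-- The per-collection data yield printed-form data (`wavg_bound_of_collBound`): the per-collection
hypothesis is the stronger one. [claim: Mochizuki2012, status: disputed] -/
def LocalProofData.toAvg (L : X.LocalProofData) : X.LocalProofDataAvg where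
  ι := L.ι
  dst := L.dst
  E := L.E
  instFintype := L.instFintype
  instNonempty := L.instNonempty
  D := L.D
  vol := L.vol
  hwavg := fun v hv j hj1 hj2 =>
    @DstLocal.wavg_bound_of_collBound (L.E v) (L.instFintype v) (L.instNonempty v) (L.D v) X.lhalf X.lstar
      (L.vol v) (L.hvol v hv) j hj1 hj2
  Z := L.Z
  hZ := L.hZ
  negLogTheta_le := L.negLogTheta_le
  logDiffK := L.logDiffK
  logCondK := L.logCondK
  logCondK_nonneg := L.logCondK_nonneg
  sum_logDK := L.sum_logDK
  sum_logQ := L.sum_logQ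
  tpd_le_F := L.tpd_le_F
  F_le := L.F_le
  K_le := L.K_le
  sQ_le := L.sQ_le
  sLe_le := L.sLe_le

end Thm110Numerics

end Literature.IUT.LogVolume

end
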